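/-
Copyright (c) 2026 the pub-hodgecm-mathlib formalisation cell (harness21).  Prover seat hodgecm-mathlib-LH4-p09 (g9), req620 Track A «(D-RAM) FOUR-FRAME» squad
(STAGE-1b, row (2) of the piece `f_{T₊}`, the (β₂) road (R-36) «PURE-CELL LEDGER, RELATIVE SIGNS»; β₂ sub-dealer LH4-p04 (g8) BETA2-BOARD v1.1 row (L-S1);
LH4-p15 (g0) ★ p862037 «the letter of a boundary cell is the c-twist»; LH4-p19 (g0) ★ `…ConeCellCleanRegimeDeep`), 2026-09-04.
-/
import Summits.HodgeConjecture.HodgeConjecture.Theorems.F0P3cDyRamConeCellCleanRegimeDeep        -- ★ (LH4-p19 (g0)): `exists_fixed_unit_hlamE_of_le`; brings ★ p861813 `exists_eq_pow_mul_map_add`, `v_map_le_pow_iff`, `v_eq_pow_of_map_eq`, `v_varpi_pow_le_pow`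
import Literature.NumberTheory.LocalFields.QuadraticOrderNormDepthIndexTwoRamified                -- ★ `v_sub_map_le_mul_pow` (the different bound `|t − σt| ≤ |t|·|ϖ|^{d−1}`)
import HarnessLib

/-!
# Crux `H413`, line LH4 «(D-RAM) FOUR-FRAME» — STAGE-1b, row (2), the (β₂) road (R-36), rows (L-S1)∕(L-K): «THE CLEAN LETTER ON TYPE (B) HOLDS UP TO THE ANTI-DEPTH ITSELF» —
# on a type-(B) place (`M ∕ jE(E)` unramified for `ρ`, `Θ` residually trivial with `|α − Θα| ≤ |jEϖ|^{d−1}`) the `E`-dominance letter `|lam − jE u₀₀ + jE(f·t₊·(ϖσϖ)^b)| ≤ |jEϖ|^{2b+N}`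
# holds for a `σ`-fixed unit `f` as soon as `N ≤ δ` (★ `…CleanRegimeDeep`: `N + d − 1 ≤ δ`), because the norm equation `Θlam·lam = 1` reads the `E`-part of `lam` to `d − 1` MORE digits
# than the size of its `ρ`-anti part — exactly the `d − 1` digits the trace ideal costs; so ★ p862037's boundary letter `hlam′` (precision `2b + δ`, `δ = c + m* − 1`) IS an instance

Cell `hodgecm-mathlib` (D-0151), FLOOR 0, crux item H413 = `stmt-HodgeConjecture-24833`, route of record `HCCMUnconditional`; squad F0∕P3c∕LH4; lane
`--supports stmt-HodgeConjecture-24833 --as helper` (count-neutral; pays NO tier-0 row).  THEOREMS ONLY (no `def`, no instance, no notation, no `sorry`, default heartbeats);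
★-only imports; states NO law; (β₂) stays a HYPOTHESIS.  DATUM-FREE local algebra in the letters of ★ `…ConeCellCleanRegimeDeep` §4 VERBATIM, plus ONE type-(B) letter
`hΘα : |α − Θα| ≤ |jEϖ|^{d−1}` (★ `ramK_frame_at_place'` delivers `|α − ρα| = 1`, `|α − Θα| < 1`; at `d = 2` — the frame of record — the two agree by discreteness) and the
`ρ`∕`Θ` letters `hΘΘ`, `hvΘ`, `hΘj`, `hintρ` already carried by every cell-letter frame (★ p861810, ★ p862037).

WHY (LH4-p09 (g9) 16:38:48Z checkpoint; LH4-p15 (g0) 16:19:20Z model «S₁ = −D at δ = 4, +D at δ ≥ 6» (d = 2, m* = 3)).  ★ p862037 reads the letter of the boundary cell `S₁ = (b + c, b)`,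
`c = 2d − 2`, off a `σ`-fixed unit `f` with `hlam′ : |μ + jE(f·t₊·(ϖσϖ)^b)| ≤ |jEϖ|^{m*−1}·|D₀^S| = |jEϖ|^{2b+δ}` where `|μ − ρμ| = |jEϖ|^{2b+δ}` (`δ = c + m* − 1`, type (B): `|α − ρα| = 1`,
`|D₀^S| = |jEϖ|^{2b+c}`) — `E`-dominance AT the anti-depth.  The only ★ producer of such an `f`, `exists_fixed_unit_hlam_of_depths_of_le`, needs `N + d − 1 ≤ δ`: one digit short at
`d = 2`, `d − 1` short in general — its norm step `|lam − jE(u + μ_E)| ≤ |jEϖ|^{2b+δ} ⇒ |N(u + μ_E) − 1| ≤ |ϖ|^{2b+δ}` (★ p861813 `v_map_norm_sub_one_le`) forgets that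
`N(u + μ_E) − 1 = −(X + ΘX) + θ·Θθ`, `X = lam·Θθ`, `θ = lam − jE(u + μ_E)`, and that on type (B) `Θ` MOVES LITTLE: `X + ΘX = 2X − (X − ΘX)` with `|2| = |ϖ|^t ≤ |ϖ|^{d−1}`
(★ `d_le_succ_t`) and `|X − ΘX| ≤ |jEϖ|^{d−1}·|X|` (§1).  So `|N(u + μ_E) − 1| ≤ |ϖ|^{2b+δ+d−1}` (§2), and ★ `exists_fixed_unit_hlamE_of_le` run at `δ + d − 1` returns `f` at every
`N ≤ δ` (§3).  (L-S1) READING (§4): `N = δ = c + m* − 1` is ★ p862037's `hlam′` (the `−1` row, `c`-twist); `N = c + m*` with `δ ≥ c + m*` is ★ p861810's `hlam` at `S₁`'s scale (the `+1`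
rows) — thresholds `δ = m* + 2d − 3` ∕ `δ ≥ m* + 2d − 2`, the model's `4` ∕ `≥ 5 (⇒ 6)` at `d = 2`.  The near cell `K₀` of (κ-b) (LH4-p16 (g0)) reads the same HEAD at its own gap.
* §1 TYPE-(B) DISPLACEMENT: `exists_eq_map_add_map_mul_of_v_le_one` (`|z| ≤ 1 ⇒ z = jE a + jE b·α`, `|jE a|, |jE b| ≤ 1` — `ρ`-coordinates from `hintρ`), `v_map_sub_map_le_mul_pow`
  (`|jE(c − σc)| ≤ |jE c|·|jEϖ|^{d−1}`, ★ `v_sub_map_le_mul_pow` across `jE`), `v_sub_map_le_pow_of_typeB` (`|w| ≤ 1 ⇒ |w − Θw| ≤ |jEϖ|^{d−1}`),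
  `v_map_mul_sub_map_le_of_typeB` (`|jE c·w − Θ(jE c·w)| ≤ |jE c|·|jEϖ|^{d−1}`), `v_map_two_le_pow` (`|jE 2| ≤ |jEϖ|^{d−1}`).
* §2 THE NORM GAIN `v_map_norm_sub_one_le_of_typeB`: `Θlam·lam = 1`, `|lam| = 1`, `lam − jE x = jE c·w`, `|w| ≤ 1` ⟹ `|jE(x·σx) − 1| ≤ max (|jE c|·|jEϖ|^{d−1}) (|jE c|·|jE c|)`.
* §3 HEAD `exists_fixed_unit_hlam_of_depths_typeB`: ★ `exists_fixed_unit_hlam_of_depths_of_le`'s binders VERBATIM with `hδ : N + d − 1 ≤ δ` REPLACED by `hδ : N ≤ δ`, plus `hΘΘ hvΘ hΘα`.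
* §4 `exists_fixed_unit_boundary_hlam_of_depths` — the (L-S1)∕(L-K) boundary letter in ★ p862037's currency: `|D₀| = |jEϖ|^{2b+c}`, `1 ≤ c`, `1 ≤ m*`, `δ = c + m* − 1`,
  `|u₀₀ − 1| ≤ |ϖ|^{δ+1}`, `δ + d − 1 ≤ 2b` ⟹ `∃ f`, `σf = f`, `|f| = 1`, `|μ + jE(f·t₊·(ϖσϖ)^b)| ≤ |jEϖ|^{m*−1}·|D₀|`.
WHAT IS NOT CLAIMED: `hjl`'s exactness and `hgap` are the consumer's cell letters (★ DEFS `levelSet`: `|Y| = |ϖE|^b`; type (B): `|D₀| = |jEϖ|^{j+b}`); `|u₀₀ − 1| ≤ |ϖ|^{δ+1}` is one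
`V`-shrink deeper than the frame's `|ϖ^{m*}|` (LH4-p04 (g8)'s `exists_nhds_one_block_congr` allows any depth); no census law.
HONEST LABEL.  Count-neutral local algebra; nothing printed is asserted; no census law is stated; `HC_CM` is proved only modulo the 7 printed citations (2 remaining named inputs:
hLiu418 = `stmt-HodgeConjecture-24832`, h413 = `stmt-HodgeConjecture-24833`) until rung 0 closes.
## References
* [Serre1979] J.-P. Serre, *Local Fields*, GTM 67 (1979): Ch. III §6 Prop. 13 (`d ≤ t + 1`), Ch. IV §1 Prop. 3–4 (`i(σ) = d`: `|x − σx| ≤ |x|·|ϖ|^{d−1}`), Ch. V §3 Cor. 3.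
* [Jacobowitz1962] R. Jacobowitz, *Hermitian forms over local fields*, Amer. J. Math. 84 (1962): §4 (the glue, `Θlam·lam = 1`).
* [Rogawski1990] J. D. Rogawski, *Automorphic Representations of Unitary Groups in Three Variables*, Ann. of Math. Stud. 123 (1990): §4.9 Prop. 4.9.1 (b) p. 55.
* [LanglandsShelstad1987] R. P. Langlands, D. Shelstad, *On the definition of transfer factors*, Math. Ann. 278 (1987): §1–§3 (κ-signs on a stable class).
-/

set_option autoImplicit false

noncomputable section

namespace Summit.HodgeConjecture.HodgeConjecture.Cruxes.H413.F0P3cDyRamConeCellCleanRegimeBoundary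

open scoped Valued WithZero
open WithZero
open Literature.NumberTheory.Automorphic.UnitaryThreeFourFrame (IsRamifiedQuadraticDatum)
open Literature.NumberTheory.LocalFields.WildQuadraticDatum (d_le_succ_t)
open Literature.NumberTheory.LocalFields.QuadraticOrder (v_sub_map_le_mul_pow)
open Summit.HodgeConjecture.HodgeConjecture.Cruxes.H413.F0P3cDyRamDiagonalCellCleanRegime
open Summit.HodgeConjecture.HodgeConjecture.Cruxes.H413.F0P3cDyRamConeCellCleanRegimeDeep (exists_fixed_unit_hlamE_of_le)

variable {E M : Type} [Field E] [Valued E ℤᵐ⁰] [Field M] [Valued M ℤᵐ⁰] {ρ Θ : M →+* M} {α : M}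

/-! ## §1 Type-(B) displacement: `Θ` moves integral elements by `d − 1` digits -/

omit [Valued E ℤᵐ⁰] in
/-- **`ρ`-COORDINATES OF AN INTEGRAL ELEMENT.**  `ρρ = 1`, `ρα ≠ α`, `|α| ≤ 1`, `hintρ : |z| ≤ 1 → |(z − ρz)∕(α − ρα)| ≤ 1`, `Fix ρ = jE(E)` ⟹ every `|z| ≤ 1` is `z = jE a + jE b·α` with
`|jE a| ≤ 1`, `|jE b| ≤ 1` (`jE b = (z − ρz)∕(α − ρα)`, `jE a = z − jE b·α`, both `ρ`-fixed). [cite: Serre1979, Ch. III §6 Prop. 12] -/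
theorem exists_eq_map_add_map_mul_of_v_le_one (hρρ : ∀ x, ρ (ρ x) = x) (hα : ρ α ≠ α) (hα1 : Valued.v α ≤ 1)
    (hint : ∀ z : M, Valued.v z ≤ 1 → Valued.v ((z - ρ z) / (α - ρ α)) ≤ 1)
    (jE : E →+* M) (hjfix : ∀ z, ρ z = z ↔ ∃ c, jE c = z) {z : M} (hz : Valued.v z ≤ 1) :
    ∃ a b : E, Valued.v (jE a) ≤ 1 ∧ Valued.v (jE b) ≤ 1 ∧ z = jE a + jE b * α := by
  have hρb' : ρ ((z - ρ z) / (α - ρ α)) = (z - ρ z) / (α - ρ α) := by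
    have e1 : ρ (z - ρ z) = -(z - ρ z) := by rw [map_sub, hρρ]; ring
    have e2 : ρ (α - ρ α) = -(α - ρ α) := by rw [map_sub, hρρ]; ring
    rw [map_div₀, e1, e2, neg_div_neg_eq]
  obtain ⟨b, hb⟩ := (hjfix _).1 hρb'
  have hb1 : Valued.v (jE b) ≤ 1 := by rw [hb]; exact hint z hz
  have hαρ : α - ρ α ≠ 0 := sub_ne_zero.2 (Ne.symm hα)
  have hbα : jE b * (α - ρ α) = z - ρ z := by rw [hb]; field_simp
  have hρa' : ρ (z - jE b * α) = z - jE b * α := by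
    rw [map_sub, map_mul, (hjfix _).2 ⟨b, rfl⟩]
    linear_combination hbα
  obtain ⟨a, ha⟩ := (hjfix _).1 hρa'
  refine ⟨a, b, ?_, hb1, ?_⟩
  · rw [ha]
    refine (Valuation.map_sub _ _ _).trans (max_le hz ?_)
    rw [Valuation.map_mul]
    calc Valued.v (jE b) * Valued.v α ≤ 1 * 1 := mul_le_mul' hb1 hα1
      _ = 1 := mul_one _
  · rw [ha]; ring

/-- **THE DIFFERENT BOUND ACROSS `jE`**: `|jE(c − σc)| ≤ |jE c|·|jEϖ|^{d−1}` (★ `v_sub_map_le_mul_pow` on `E`, transported by `|jE x| ≤ |jEϖ|ⁿ ↔ |x| ≤ |ϖ|ⁿ`).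
[cite: Serre1979, Ch. IV §1 Prop. 3–4] -/
theorem v_map_sub_map_le_mul_pow {σ : E →+* E} {ϖ : E} {d t : ℕ} (hD : IsRamifiedQuadraticDatum σ ϖ d t)
    (jE : E →+* M) (hjv : ∀ c, Valued.v (jE c) ≤ 1 ↔ Valued.v c ≤ 1) (c : E) :
    Valued.v (jE (c - σ c)) ≤ Valued.v (jE c) * Valued.v (jE ϖ) ^ (d - 1) := by
  obtain ⟨hσσ, hvσ, hϖ, hfix, hdd, -, -⟩ := hD
  have hvϖ0 : Valued.v ϖ ≠ 0 := by rw [hϖ]; exact exp_ne_zero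
  have hϖ0 : ϖ ≠ 0 := fun h0 => by rw [h0, map_zero] at hvϖ0; exact hvϖ0 rfl
  by_cases hc0 : c = 0
  · rw [hc0, map_zero, sub_zero, map_zero, Valuation.map_zero, zero_mul]
  have hcv : Valued.v c ≠ 0 := (Valuation.ne_zero_iff _).2 hc0
  have hjc0 : Valued.v (jE c) ≠ 0 := (Valuation.ne_zero_iff _).2 ((map_ne_zero jE).2 hc0)
  have h1 := v_sub_map_le_mul_pow hσσ hvσ hfix hϖ hdd c
  have h2 : Valued.v ((c - σ c) / c) ≤ Valued.v ϖ ^ (d - 1) := by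
    rw [map_div₀, div_le_iff₀ (zero_lt_iff.2 hcv), mul_comm]; exact h1
  have h3 := (v_map_le_pow_iff jE hjv hϖ0 _ _).2 h2
  rw [map_div₀, map_div₀, div_le_iff₀ (zero_lt_iff.2 hjc0), mul_comm] at h3
  exact h3

/-- **TYPE-(B) DISPLACEMENT OF INTEGRAL ELEMENTS**: `|w| ≤ 1 ⇒ |w − Θw| ≤ |jEϖ|^{d−1}` (`w = jE a + jE b·α`, `Θ ∘ jE = jE ∘ σ`, §1 on `a, b`, and the type letter `|α − Θα| ≤ |jEϖ|^{d−1}`).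
[cite: Serre1979, Ch. IV §1 Prop. 3–4] [cite: Serre1979, Ch. III §6 Prop. 12] -/
theorem v_sub_map_le_pow_of_typeB {σ : E →+* E} {ϖ : E} {d t : ℕ} (hD : IsRamifiedQuadraticDatum σ ϖ d t)
    (hρρ : ∀ x, ρ (ρ x) = x) (hα : ρ α ≠ α) (hα1 : Valued.v α ≤ 1) (hint : ∀ z : M, Valued.v z ≤ 1 → Valued.v ((z - ρ z) / (α - ρ α)) ≤ 1)
    (jE : E →+* M) (hjv : ∀ c, Valued.v (jE c) ≤ 1 ↔ Valued.v c ≤ 1) (hjfix : ∀ z, ρ z = z ↔ ∃ c, jE c = z)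
    (hΘj : ∀ c, Θ (jE c) = jE (σ c)) (hvΘ : ∀ x, Valued.v (Θ x) = Valued.v x)
    (hΘα : Valued.v (α - Θ α) ≤ Valued.v (jE ϖ) ^ (d - 1)) {w : M} (hw : Valued.v w ≤ 1) :
    Valued.v (w - Θ w) ≤ Valued.v (jE ϖ) ^ (d - 1) := by
  obtain ⟨a, b, ha, hb, rfl⟩ := exists_eq_map_add_map_mul_of_v_le_one hρρ hα hα1 hint jE hjfix hw
  have hEa : ∀ c : E, Valued.v (jE c) ≤ 1 → Valued.v (jE (c - σ c)) ≤ Valued.v (jE ϖ) ^ (d - 1) := fun c hc =>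
    (v_map_sub_map_le_mul_pow hD jE hjv c).trans
      (by calc Valued.v (jE c) * Valued.v (jE ϖ) ^ (d - 1) ≤ 1 * Valued.v (jE ϖ) ^ (d - 1) := mul_le_mul' hc le_rfl
            _ = _ := one_mul _)
  have e : jE a + jE b * α - Θ (jE a + jE b * α) = jE (a - σ a) + jE (b - σ b) * α + jE (σ b) * (α - Θ α) := by
    rw [map_add, map_mul, hΘj, hΘj, map_sub, map_sub]; ring
  rw [e]
  have hσb : Valued.v (jE (σ b)) ≤ 1 := by rw [← hΘj, hvΘ]; exact hb
  refine (Valuation.map_add _ _ _).trans (max_le ((Valuation.map_add _ _ _).trans (max_le (hEa a ha) ?_)) ?_)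
  · rw [Valuation.map_mul]
    calc Valued.v (jE (b - σ b)) * Valued.v α ≤ Valued.v (jE ϖ) ^ (d - 1) * 1 := mul_le_mul' (hEa b hb) hα1
      _ = _ := mul_one _
  · rw [Valuation.map_mul]
    calc Valued.v (jE (σ b)) * Valued.v (α - Θ α) ≤ 1 * Valued.v (jE ϖ) ^ (d - 1) := mul_le_mul' hσb hΘα
      _ = _ := one_mul _

/-- **TYPE-(B) DISPLACEMENT, RELATIVE FORM**: `|w| ≤ 1 ⇒ |jE c·w − Θ(jE c·w)| ≤ |jE c|·|jEϖ|^{d−1}`. [cite: Serre1979, Ch. IV §1 Prop. 3–4] -/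
theorem v_map_mul_sub_map_le_of_typeB {σ : E →+* E} {ϖ : E} {d t : ℕ} (hD : IsRamifiedQuadraticDatum σ ϖ d t)
    (hρρ : ∀ x, ρ (ρ x) = x) (hα : ρ α ≠ α) (hα1 : Valued.v α ≤ 1) (hint : ∀ z : M, Valued.v z ≤ 1 → Valued.v ((z - ρ z) / (α - ρ α)) ≤ 1)
    (jE : E →+* M) (hjv : ∀ c, Valued.v (jE c) ≤ 1 ↔ Valued.v c ≤ 1) (hjfix : ∀ z, ρ z = z ↔ ∃ c, jE c = z)
    (hΘj : ∀ c, Θ (jE c) = jE (σ c)) (hvΘ : ∀ x, Valued.v (Θ x) = Valued.v x)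
    (hΘα : Valued.v (α - Θ α) ≤ Valued.v (jE ϖ) ^ (d - 1)) (c : E) {w : M} (hw : Valued.v w ≤ 1) :
    Valued.v (jE c * w - Θ (jE c * w)) ≤ Valued.v (jE c) * Valued.v (jE ϖ) ^ (d - 1) := by
  have e : jE c * w - Θ (jE c * w) = jE c * (w - Θ w) + jE (c - σ c) * Θ w := by rw [map_mul, hΘj, map_sub]; ring
  rw [e]
  refine (Valuation.map_add _ _ _).trans (max_le ?_ ?_)
  · rw [Valuation.map_mul]
    exact mul_le_mul' le_rfl (v_sub_map_le_pow_of_typeB hD hρρ hα hα1 hint jE hjv hjfix hΘj hvΘ hΘα hw)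
  · rw [Valuation.map_mul, hvΘ]
    calc Valued.v (jE (c - σ c)) * Valued.v w ≤ (Valued.v (jE c) * Valued.v (jE ϖ) ^ (d - 1)) * 1 :=
        mul_le_mul' (v_map_sub_map_le_mul_pow hD jE hjv c) hw
      _ = _ := mul_one _

/-- **`|jE 2| ≤ |jEϖ|^{d−1}`** (`|2| = |ϖ|^t`, ★ `d_le_succ_t : d ≤ t + 1`). [cite: Serre1979, Ch. III §6 Prop. 13] -/
theorem v_map_two_le_pow {σ : E →+* E} {ϖ : E} {d t : ℕ} (hD : IsRamifiedQuadraticDatum σ ϖ d t)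
    (jE : E →+* M) (hjv : ∀ c, Valued.v (jE c) ≤ 1 ↔ Valued.v c ≤ 1) : Valued.v (jE 2) ≤ Valued.v (jE ϖ) ^ (d - 1) := by
  obtain ⟨hσσ, -, hϖ, hfix, hdd, -, ht⟩ := hD
  have hvϖ0 : Valued.v ϖ ≠ 0 := by rw [hϖ]; exact exp_ne_zero
  have hϖ0 : ϖ ≠ 0 := fun h0 => by rw [h0, map_zero] at hvϖ0; exact hvϖ0 rfl
  have hdt := d_le_succ_t hσσ hfix hϖ hdd ht
  refine (v_map_le_pow_iff jE hjv hϖ0 _ _).2 ?_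
  rw [ht]; exact v_varpi_pow_le_pow hϖ (by omega)

/-! ## §2 The norm gain on type (B) -/

/-- **THE NORM GAIN.**  `Θlam·lam = 1`, `|lam| = 1`, `lam − jE x = jE c·w` with `|w| ≤ 1` (the anti part of the eigenvalue at scale `|jE c|`), type (B) ⟹
`|jE(x·σx) − 1| ≤ max (|jE c|·|jEϖ|^{d−1}) (|jE c|·|jE c|)`: `jE(xσx) − 1 = −(X + ΘX) + θΘθ`, `X = lam·Θθ = jE(σc)·(lam·Θw)`, `X + ΘX = 2X − (X − ΘX)` (§1).
[cite: Jacobowitz1962, §4] [cite: Serre1979, Ch. IV §1 Prop. 3–4] -/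
theorem v_map_norm_sub_one_le_of_typeB {σ : E →+* E} {ϖ : E} {d t : ℕ} (hD : IsRamifiedQuadraticDatum σ ϖ d t)
    (hρρ : ∀ x, ρ (ρ x) = x) (hα : ρ α ≠ α) (hα1 : Valued.v α ≤ 1) (hint : ∀ z : M, Valued.v z ≤ 1 → Valued.v ((z - ρ z) / (α - ρ α)) ≤ 1)
    (jE : E →+* M) (hjv : ∀ c, Valued.v (jE c) ≤ 1 ↔ Valued.v c ≤ 1) (hjfix : ∀ z, ρ z = z ↔ ∃ c, jE c = z)
    (hΘΘ : ∀ x, Θ (Θ x) = x) (hΘj : ∀ c, Θ (jE c) = jE (σ c)) (hvΘ : ∀ x, Valued.v (Θ x) = Valued.v x)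
    (hΘα : Valued.v (α - Θ α) ≤ Valued.v (jE ϖ) ^ (d - 1))
    {lam : M} (hΘlam : Θ lam * lam = 1) (hlam1 : Valued.v lam = 1) {x c : E} {w : M} (hw : Valued.v w ≤ 1) (hθ : lam - jE x = jE c * w) :
    Valued.v (jE (x * σ x) - 1) ≤ max (Valued.v (jE c) * Valued.v (jE ϖ) ^ (d - 1)) (Valued.v (jE c) * Valued.v (jE c)) := by
  have hjx : jE x = lam - jE c * w := by rw [← hθ]; ring
  have hX : lam * Θ (jE c * w) = jE (σ c) * (lam * Θ w) := by rw [map_mul, hΘj]; ring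
  have hkey : jE (x * σ x) - 1 = -(jE (σ c) * (lam * Θ w) + Θ (jE (σ c) * (lam * Θ w))) + jE c * w * Θ (jE c * w) := by
    rw [← hX, map_mul Θ lam, hΘΘ, map_mul jE, ← hΘj, hjx, map_sub]
    linear_combination hΘlam
  rw [hkey]
  have hθv : Valued.v (jE c * w) ≤ Valued.v (jE c) := by
    rw [Valuation.map_mul]
    calc Valued.v (jE c) * Valued.v w ≤ Valued.v (jE c) * 1 := mul_le_mul' le_rfl hw
      _ = _ := mul_one _
  have hσc : Valued.v (jE (σ c)) = Valued.v (jE c) := by rw [← hΘj, hvΘ]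
  have hw' : Valued.v (lam * Θ w) ≤ 1 := by
    rw [Valuation.map_mul, hlam1, one_mul, hvΘ]; exact hw
  set X : M := jE (σ c) * (lam * Θ w) with hXdef
  have hXv : Valued.v X ≤ Valued.v (jE c) := by
    rw [hXdef, Valuation.map_mul, hσc]
    calc Valued.v (jE c) * Valued.v (lam * Θ w) ≤ Valued.v (jE c) * 1 := mul_le_mul' le_rfl hw'
      _ = _ := mul_one _
  have hTr : Valued.v (X + Θ X) ≤ Valued.v (jE c) * Valued.v (jE ϖ) ^ (d - 1) := by
    have e : X + Θ X = jE 2 * X - (X - Θ X) := by rw [map_ofNat]; ring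
    rw [e]
    refine (Valuation.map_sub _ _ _).trans (max_le ?_ ?_)
    · rw [Valuation.map_mul, mul_comm]
      exact mul_le_mul' hXv (v_map_two_le_pow hD jE hjv)
    · rw [hXdef, ← hσc]
      exact v_map_mul_sub_map_le_of_typeB hD hρρ hα hα1 hint jE hjv hjfix hΘj hvΘ hΘα (σ c) hw'
  refine (Valuation.map_add _ _ _).trans (max_le_max ?_ ?_)
  · rw [Valuation.map_neg]; exact hTr
  · rw [Valuation.map_mul, hvΘ]; exact mul_le_mul' hθv hθv

/-! ## §3 HEAD — the clean letter on type (B) at every precision `N ≤ δ` -/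

/-- **HEAD — «THE CLEAN REGIME ON TYPE (B) REACHES THE ANTI-DEPTH»: `d` EVEN, `1 ≤ N`, `|u₀₀ − 1| ≤ |ϖ|^{N+1}`, `N + d − 1 ≤ 2b`, `N ≤ δ`, type (B) ⟹
`∃ f`, `σ f = f`, `|f| = 1`, `|lam − jE u₀₀ + jE(f·t₊·(ϖσϖ)^b)| ≤ |jEϖ|^{2b + N}`** — binders of ★ `exists_fixed_unit_hlam_of_depths_of_le` VERBATIM with `hδ : N + d − 1 ≤ δ` replaced by
`hδ : N ≤ δ`, plus `hΘΘ`, `hvΘ`, `hΘα : |α − Θα| ≤ |jEϖ|^{d−1}` (proof: ★ §4's decomposition `μ = jEϖ^{2b}·jE e + jEϖ^{2b+δ}·y`, the NORM GAIN §2 `|N(u + μ_E) − 1| ≤ |ϖ|^{2b+δ+d−1}`, then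
★ `exists_fixed_unit_hlamE_of_le` at `δ + d − 1`). [cite: Serre1979, Ch. IV §1 Prop. 3–4] [cite: Serre1979, Ch. III §6 Prop. 12] [cite: Jacobowitz1962, §4]
[cite: Rogawski1990, §4.9 Prop. 4.9.1 (b) p. 55] -/
theorem exists_fixed_unit_hlam_of_depths_typeB {σ : E →+* E} {ϖ : E} {d t : ℕ} (hD : IsRamifiedQuadraticDatum σ ϖ d t) (hd2 : d % 2 = 0) {N : ℕ} (hN1 : 1 ≤ N)
    (hρρ : ∀ x, ρ (ρ x) = x) (hα : ρ α ≠ α) (hα1 : Valued.v α ≤ 1) (hint : ∀ z : M, Valued.v z ≤ 1 → Valued.v ((z - ρ z) / (α - ρ α)) ≤ 1)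
    (jE : E →+* M) (hjv : ∀ c, Valued.v (jE c) ≤ 1 ↔ Valued.v c ≤ 1) (hjfix : ∀ z, ρ z = z ↔ ∃ c, jE c = z)
    (hΘΘ : ∀ x, Θ (Θ x) = x) (hΘj : ∀ c, Θ (jE c) = jE (σ c)) (hvΘ : ∀ x, Valued.v (Θ x) = Valued.v x)
    (hΘα : Valued.v (α - Θ α) ≤ Valued.v (jE ϖ) ^ (d - 1))
    {lam : M} (hΘlam : Θ lam * lam = 1) (hlam1 : Valued.v lam = 1)
    {u : E} (huu : u * σ u = 1) (hu1 : Valued.v (u - 1) ≤ Valued.v ϖ ^ (N + 1))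
    {b δ : ℕ} (hm : Valued.v (lam - jE u) = Valued.v (jE ϖ) ^ (2 * b))
    (hjl : Valued.v ((lam - jE u) - ρ (lam - jE u)) ≤ Valued.v (jE ϖ ^ (2 * b + δ) * (α - ρ α)))
    (hb : N + d - 1 ≤ 2 * b) (hδ : N ≤ δ) :
    ∃ f : E, σ f = f ∧ Valued.v f = 1 ∧
      Valued.v (lam - jE u + jE (f * ((ϖ - σ ϖ) * ((ϖ * σ ϖ) ^ ((d - d % 2) / 2))⁻¹) * (ϖ * σ ϖ) ^ b)) ≤ Valued.v (jE ϖ) ^ (2 * b + N) := by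
  have hϖ := hD.2.2.1
  have hvϖ0 : Valued.v ϖ ≠ 0 := by rw [hϖ]; exact exp_ne_zero
  have hϖ0 : ϖ ≠ 0 := fun h0 => by rw [h0, map_zero] at hvϖ0; exact hvϖ0 rfl
  have hπ0 : jE ϖ ≠ 0 := (map_ne_zero jE).2 hϖ0
  have hπ1 : Valued.v (jE ϖ) ≤ 1 := (hjv ϖ).2 (by rw [hϖ, ← exp_zero, exp_le_exp]; norm_num)
  have hρπ : ρ (jE ϖ) = jE ϖ := (hjfix _).2 ⟨ϖ, rfl⟩
  have hd1 : 1 ≤ d := hD.2.2.2.2.2.1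
  have hδ1 : 1 ≤ δ := le_trans hN1 hδ
  set μ : M := lam - jE u with hμdef
  obtain ⟨e, y, he1, hy1, hμey⟩ := exists_eq_pow_mul_map_add hρρ hα hα1 hint jE hjfix hρπ hπ0 hπ1 hm.le hjl
  set μE : E := ϖ ^ (2 * b) * e with hμEdef
  have hjμE : jE μE = jE ϖ ^ (2 * b) * jE e := by rw [hμEdef, map_mul, map_pow]
  have hθ : μ - jE μE = jE ϖ ^ (2 * b + δ) * y := by rw [hμey, hjμE]; ring
  have hvθ : Valued.v (μ - jE μE) ≤ Valued.v (jE ϖ) ^ (2 * b + δ) := by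
    rw [hθ, Valuation.map_mul, Valuation.map_pow]
    calc Valued.v (jE ϖ) ^ (2 * b + δ) * Valued.v y ≤ Valued.v (jE ϖ) ^ (2 * b + δ) * 1 := by gcongr
      _ = _ := mul_one _
  have hπlt : Valued.v (jE ϖ) < 1 := by
    refine lt_of_le_of_ne hπ1 fun h1 => ?_
    have h0 := v_eq_pow_of_map_eq jE hjv hϖ0 (c := ϖ) (n := 0) (by rw [pow_zero, h1])
    rw [pow_zero, hϖ, ← exp_zero] at h0
    exact absurd (exp_injective h0) (by norm_num)
  have hvμE : Valued.v μE = Valued.v ϖ ^ (2 * b) := by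
    refine v_eq_pow_of_map_eq jE hjv hϖ0 ?_
    have hlt : Valued.v (-(μ - jE μE)) < Valued.v μ := by
      rw [Valuation.map_neg, hm]
      refine lt_of_le_of_lt hvθ ?_
      exact pow_lt_pow_right_of_lt_one₀ (zero_lt_iff.2 ((Valuation.ne_zero_iff _).2 hπ0)) hπlt (Nat.lt_add_of_pos_right hδ1)
    have h2 : jE μE = μ + -(μ - jE μE) := by ring
    rw [h2, Valuation.map_add_eq_of_lt_left _ hlt, hm]
  -- the NORM GAIN (§2): the anti part `θ = jE(ϖ^{2b+δ})·y` is read by `Θlam·lam = 1` to `d − 1` more digits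
  have hθ' : lam - jE (u + μE) = jE (ϖ ^ (2 * b + δ)) * y := by
    have : lam - jE (u + μE) = μ - jE μE := by rw [hμdef, map_add]; ring
    rw [this, hθ, map_pow]
  have hN' := v_map_norm_sub_one_le_of_typeB hD hρρ hα hα1 hint jE hjv hjfix hΘΘ hΘj hvΘ hΘα hΘlam hlam1 hy1 hθ'
  have hdb : d - 1 ≤ 2 * b + δ := by omega
  have hN'' : Valued.v (jE ((u + μE) * σ (u + μE)) - 1) ≤ Valued.v (jE ϖ) ^ (2 * b + (δ + d - 1)) := by
    refine hN'.trans (max_le ?_ ?_)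
    · rw [map_pow, Valuation.map_pow, ← pow_add]
      exact pow_le_pow_right_of_le_one' hπ1 (by omega)
    · rw [map_pow, Valuation.map_pow, ← pow_add]
      exact pow_le_pow_right_of_le_one' hπ1 (by omega)
  have hNE : Valued.v ((u + μE) * σ (u + μE) - 1) ≤ Valued.v ϖ ^ (2 * b + (δ + d - 1)) := by
    refine (v_map_le_pow_iff jE hjv hϖ0 _ _).1 ?_
    rw [map_sub, map_one]; exact hN''
  obtain ⟨f, hσf, hf1, hfE⟩ := exists_fixed_unit_hlamE_of_le hD hd2 hN1 huu hu1 hvμE hNE hb (by omega)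
  refine ⟨f, hσf, hf1, ?_⟩
  have hfM : Valued.v (jE (μE + f * ((ϖ - σ ϖ) * ((ϖ * σ ϖ) ^ ((d - d % 2) / 2))⁻¹) * (ϖ * σ ϖ) ^ b)) ≤ Valued.v (jE ϖ) ^ (2 * b + N) :=
    (v_map_le_pow_iff jE hjv hϖ0 _ _).2 hfE
  have hsplit : μ + jE (f * ((ϖ - σ ϖ) * ((ϖ * σ ϖ) ^ ((d - d % 2) / 2))⁻¹) * (ϖ * σ ϖ) ^ b) =
      (μ - jE μE) + jE (μE + f * ((ϖ - σ ϖ) * ((ϖ * σ ϖ) ^ ((d - d % 2) / 2))⁻¹) * (ϖ * σ ϖ) ^ b) := by rw [map_add]; ring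
  rw [hsplit]
  exact (Valuation.map_add _ _ _).trans (max_le (hvθ.trans (pow_le_pow_right_of_le_one' hπ1 (Nat.add_le_add_left hδ _))) hfM)

/-! ## §4 The (L-S1)∕(L-K) boundary letter in ★ p862037's currency -/

/-- **THE BOUNDARY `E`-DOMINANCE LETTER FROM THE DEPTHS.**  Type (B); a cell of conductor gap `c ≥ 1` above the tube depth `b`, `|D₀| = |jEϖ|^{2b+c}` (★ DEFS `levelSet`: `|Y| = |ϖE|^b`,
`|cc| = |ϖE|^{b+c}`, `|α − ρα| = 1`); label modulus `m* ≥ 1`; the key's anti-depth AT the boundary `δ = c + m* − 1` (`|μ − ρμ| ≤ |jEϖ|^{2b+δ}·|α − ρα|`), `|μ| = |jEϖ|^{2b}`,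
`|u₀₀ − 1| ≤ |ϖ|^{δ+1}`, `δ + d − 1 ≤ 2b`, `d` even ⟹ `∃ f`, `σf = f`, `|f| = 1`, `|μ + jE(f·t₊·(ϖσϖ)^b)| ≤ |jEϖ|^{m*−1}·|D₀|` — ★ p862037's `hlam′` (with its `hjl`, `hgap` the cell's own
letters), whence «the letter of the boundary cell is the `c`-twist of the diagonal letter» at `q = 2`. [cite: Serre1979, Ch. IV §1 Prop. 3–4] [cite: Jacobowitz1962, §4]
[cite: Rogawski1990, §4.9 Prop. 4.9.1 (b) p. 55] [cite: LanglandsShelstad1987, §1–§3] -/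
theorem exists_fixed_unit_boundary_hlam_of_depths {σ : E →+* E} {ϖ : E} {d t : ℕ} (hD : IsRamifiedQuadraticDatum σ ϖ d t) (hd2 : d % 2 = 0)
    (hρρ : ∀ x, ρ (ρ x) = x) (hα : ρ α ≠ α) (hα1 : Valued.v α ≤ 1) (hint : ∀ z : M, Valued.v z ≤ 1 → Valued.v ((z - ρ z) / (α - ρ α)) ≤ 1)
    (jE : E →+* M) (hjv : ∀ c, Valued.v (jE c) ≤ 1 ↔ Valued.v c ≤ 1) (hjfix : ∀ z, ρ z = z ↔ ∃ c, jE c = z)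
    (hΘΘ : ∀ x, Θ (Θ x) = x) (hΘj : ∀ c, Θ (jE c) = jE (σ c)) (hvΘ : ∀ x, Valued.v (Θ x) = Valued.v x)
    (hΘα : Valued.v (α - Θ α) ≤ Valued.v (jE ϖ) ^ (d - 1))
    {lam : M} (hΘlam : Θ lam * lam = 1) (hlam1 : Valued.v lam = 1) {u : E} (huu : u * σ u = 1)
    {b c ms δ : ℕ} (hc1 : 1 ≤ c) (hms1 : 1 ≤ ms) (hδ : δ = c + ms - 1) (hu1 : Valued.v (u - 1) ≤ Valued.v ϖ ^ (δ + 1)) (hb : δ + d - 1 ≤ 2 * b)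
    (hm : Valued.v (lam - jE u) = Valued.v (jE ϖ) ^ (2 * b))
    (hjl : Valued.v ((lam - jE u) - ρ (lam - jE u)) ≤ Valued.v (jE ϖ ^ (2 * b + δ) * (α - ρ α)))
    {D₀ : M} (hD₀ : Valued.v D₀ = Valued.v (jE ϖ) ^ (2 * b + c)) :
    ∃ f : E, σ f = f ∧ Valued.v f = 1 ∧
      Valued.v (lam - jE u + jE (f * ((ϖ - σ ϖ) * ((ϖ * σ ϖ) ^ ((d - d % 2) / 2))⁻¹) * (ϖ * σ ϖ) ^ b)) ≤ Valued.v (jE ϖ) ^ (ms - 1) * Valued.v D₀ := by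
  have hδ1 : 1 ≤ δ := by omega
  obtain ⟨f, hσf, hf1, hle⟩ := exists_fixed_unit_hlam_of_depths_typeB hD hd2 hδ1 hρρ hα hα1 hint jE hjv hjfix hΘΘ hΘj hvΘ hΘα hΘlam hlam1 huu hu1 hm hjl hb le_rfl
  refine ⟨f, hσf, hf1, ?_⟩
  rw [hD₀, ← pow_add]
  have h : ms - 1 + (2 * b + c) = 2 * b + δ := by omega
  rw [h]; exact hle

end Summit.HodgeConjecture.HodgeConjecture.Cruxes.H413.F0P3cDyRamConeCellCleanRegimeBoundary

end
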